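import Summits.Parity.GeneralizedHardyLittlewood.Theorems.FordMaynardSieveConst01651SieveConst01651LinePart04
import HarnessLib

/-!
# Route `FordMaynardSieveConst01651`, target `SieveConst01651` (stmt-Parity-19185): line `sieve_decomposition` re-homed — proofs, part 5 of 11 (file 6 of 12)

File 6 of 12 of the VERBATIM re-homing under `Theorems/` of the registered line skeleton
`Summits/Parity/GeneralizedHardyLittlewood/Cruxes/SieveConst01651/Lines/sieve_decomposition.lean` (v21, sha16
`ada6d0765119a11e`; author seat `linewriter-parity-smallroutes-1`, g0 v1–v20 / g1 v21): Ford–Maynard, Theorem 7.3 (a) at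
`P = (1/2, 0, ν)` with CLOSED support, cut along arXiv:2407.14368 §7.2 / §6.2, composed down to the route target
`Summit.Parity.GeneralizedHardyLittlewood.Theses.FordMaynardSieveConst01651.SieveConst01651`.  Namespace
`Summit.Parity.GeneralizedHardyLittlewood.FordMaynardSieveConst01651SieveDecomposition` (fresh; the `Cruxes` copy keeps its own), files of
≤ 400 lines chained by import; the three registered stubs are replaced by their landed proofs
(`…StubSignClauseFive` p834287, `…StubCertValuePos` p837763, `…TypeIIRegion` p833045), so the skeleton's composition
`SieveConst01651_of_stubs` (last part) is sorry-free.  Mathematics, statements and comments are the linewriter's; this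
re-homing (hand `leafhand-parity-fordmaynardsieveco-2` g4) only moved the definitions (`Eset`, `sliceTest`, `mainG1`, `vk`,
the `Signature.*` statement abbreviations, `Phi`, `innerI`, `jumpSet`, `gval`, `symmExt`, `idxProd`, `gam`) into the first
file, added docstrings where missing, and renamed two unused binders.
Declarations in this part: `chebyshev_window`, `eventually_small`, `roughPart_eq_self_of_rough`, `smoothPart_eq_one_of_rough`, `apply_pvec_eq_zero_of_sqrt_lt`, `Gwt_eq_of_rough`, `Hwt_eq_sum_of_rough`, `apply_congr_ofFn`, `ofFn_pvec`, `idxProd_dvd`, `primeFactorsList_idxProd`, `apply_idxProd_eq`, `idxProd_injective`, `card_divisors_of_squarefree`, `sum_divisors_eq_starSum`, `two_le_length_of_not_prime`, `nu_lt_pvec`, `pvec_nonneg`, `entries_of_sum_eq_one`, `sign_of_squarefree`, `apply_eq_of_perm_ofFn`, `gam_coe_ofFn`.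

References: [FordMaynard2024PrimeSieves] K. Ford, J. Maynard, *On the theory of prime producing sieves*, arXiv:2407.14368,
Theorem 7.3 (a), Proposition 7.19, §6.2, §7.2, §8.2.
-/

noncomputable section

open Finset
open Literature.NumberTheory.Sieve Literature.NumberTheory.Sieve.FordMaynard Literature.Barriers.Parity.FordMaynard
open Summit.Parity.GeneralizedHardyLittlewood.FordMaynardSieveConst01651SieveConst01651
  (hfun Admissible hfun_apply hfun_of_ne pvec roughPart smoothPart Gwt Hwt window IsRough Nset Rset mem_window mem_Nset mem_Rset
   coneCert openSmall stub_hkPieces stub_coneCertClosed_of_residues' coneCert_signClause_five_of_generic)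

namespace Summit.Parity.GeneralizedHardyLittlewood.FordMaynardSieveConst01651SieveDecomposition

/-- `chebyshev_window` — lemma of the line skeleton `sieve_decomposition` (v21, seat `linewriter-parity-smallroutes-1`), re-homed verbatim. [folklore] -/
theorem chebyshev_window : ∃ x₀ : ℝ, ∀ x : ℝ, x₀ ≤ x → x / (3 * Real.log x) ≤ ((windowPrimes x).card : ℝ) := by
  obtain ⟨x₁, hx₁⟩ :=
    Literature.Barriers.Parity.FriedlanderGranville.primeCounting_bounds (ε := 1 / 20) (by norm_num)
  refine ⟨max (2 * x₁) ((2 : ℝ) ^ 16), fun x hx => ?_⟩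
  have hbig : (2 : ℝ) ^ 16 ≤ x := (le_max_right _ _).trans hx
  have h2x₁ : 2 * x₁ ≤ x := (le_max_left _ _).trans hx
  have hx0 : 0 < x := lt_of_lt_of_le (by norm_num) hbig
  have hx1 : x₁ ≤ x := by
    rcases le_or_gt 0 x₁ with h | h
    · linarith
    · linarith
  have hx1' : x₁ ≤ x / 2 := by linarith
  have hlog2 : 0 < Real.log 2 := Real.log_pos (by norm_num)
  have hL : 16 * Real.log 2 ≤ Real.log x := by
    have h := Real.log_le_log (by positivity) hbig
    rw [Real.log_pow] at h
    push_cast at h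
    exact h
  have hLx : 0 < Real.log x := by linarith
  have hsub : Real.log (x / 2) = Real.log x - Real.log 2 := Real.log_div hx0.ne' two_ne_zero
  have hL2pos : 0 < Real.log x - Real.log 2 := by linarith
  set X : ℝ := x / Real.log x with hX
  have hX0 : 0 ≤ X := div_nonneg hx0.le hLx.le
  set Y : ℝ := x / 2 / Real.log (x / 2) with hY
  have hA := abs_le.1 (hx₁ x hx1)
  have hB := abs_le.1 (hx₁ (x / 2) hx1')
  have hYX : Y ≤ 8 / 15 * X := by
    rw [hY, hsub, div_le_iff₀ hL2pos, hX]
    have h1516 : 15 / 16 * Real.log x ≤ Real.log x - Real.log 2 := by linarith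
    calc x / 2 = 8 / 15 * (x / Real.log x) * (15 / 16 * Real.log x) := by
          field_simp; ring
      _ ≤ 8 / 15 * (x / Real.log x) * (Real.log x - Real.log 2) :=
          mul_le_mul_of_nonneg_left h1516 (by positivity)
  have hcard := card_windowPrimes_eq hx0.le
  have hX3 : x / (3 * Real.log x) = X / 3 := by rw [hX]; ring
  rw [hX3, hcard]
  linarith [hA.1, hB.2]

/-- `eventually_small` — lemma of the line skeleton `sieve_decomposition` (v21, seat `linewriter-parity-smallroutes-1`), re-homed verbatim. [folklore] -/
theorem eventually_small {ν η : ℝ} (hν : 0 < ν) (hη : 0 < η) :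
    ∃ x₁ : ℝ, ∀ x : ℝ, x₁ ≤ x → 4 ≤ x ∧ 1 ≤ Real.log x ∧
      x ^ (1 - ν) ≤ η * x / Real.log x ∧ x / Real.log x ^ (2 : ℕ) ≤ η * x / Real.log x := by
  have h1 : ∀ᶠ x : ℝ in Filter.atTop, ‖Real.log x‖ ≤ η * ‖x ^ ν‖ :=
    (isLittleO_log_rpow_atTop hν).bound hη
  have h2 : ∀ᶠ x : ℝ in Filter.atTop, (4 : ℝ) ≤ x := Filter.eventually_ge_atTop 4
  have h3 : ∀ᶠ x : ℝ in Filter.atTop, Real.exp 1 ≤ x := Filter.eventually_ge_atTop _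
  have h4 : ∀ᶠ x : ℝ in Filter.atTop, Real.exp (1 / η) ≤ x := Filter.eventually_ge_atTop _
  obtain ⟨x₁, hx₁⟩ := Filter.eventually_atTop.1 (h1.and (h2.and (h3.and h4)))
  refine ⟨x₁, fun x hx => ?_⟩
  obtain ⟨hlog, h4x, hex, heη⟩ := hx₁ x hx
  have hx0 : 0 < x := by linarith
  have hL1 : 1 ≤ Real.log x := by
    rw [← Real.log_exp 1]; exact Real.log_le_log (Real.exp_pos 1) hex
  have hL0 : 0 < Real.log x := by linarith
  refine ⟨h4x, hL1, ?_, ?_⟩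
  · rw [le_div_iff₀ hL0]
    rw [Real.norm_eq_abs, Real.norm_eq_abs, abs_of_pos hL0, abs_of_pos (Real.rpow_pos_of_pos hx0 ν)] at hlog
    have hsplit : x ^ (1 - ν) * x ^ ν = x := by
      rw [← Real.rpow_add hx0]; norm_num
    calc x ^ (1 - ν) * Real.log x ≤ x ^ (1 - ν) * (η * x ^ ν) :=
          mul_le_mul_of_nonneg_left hlog (Real.rpow_nonneg hx0.le _)
      _ = η * (x ^ (1 - ν) * x ^ ν) := by ring
      _ = η * x := by rw [hsplit]
  · have hL2 : 1 / η ≤ Real.log x := by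
      rw [← Real.log_exp (1 / η)]; exact Real.log_le_log (Real.exp_pos _) heη
    have hinv : 1 / Real.log x ≤ η := by
      rw [div_le_iff₀ hL0]
      rw [div_le_iff₀ hη] at hL2
      linarith
    have hsplit : x / Real.log x ^ (2 : ℕ) = (x / Real.log x) * (1 / Real.log x) := by
      rw [div_mul_div_comm, mul_one, pow_two]
    rw [hsplit]
    calc x / Real.log x * (1 / Real.log x) ≤ x / Real.log x * η :=
          mul_le_mul_of_nonneg_left hinv (div_nonneg hx0.le hL0.le)
      _ = η * x / Real.log x := by ring

/-- `roughPart_eq_self_of_rough` — lemma of the line skeleton `sieve_decomposition` (v21, seat `linewriter-parity-smallroutes-1`), re-homed verbatim. [folklore] -/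
theorem roughPart_eq_self_of_rough {ν : ℝ} {n d : ℕ} (hn : n ≠ 0) (hr : IsRough ν n) (hdvd : d ∣ n)
    (hd : d ≠ 0) : roughPart ((n : ℝ) ^ ν) d = d := by
  unfold roughPart
  have hfilter : d.primeFactors.filter (fun p : ℕ => (n : ℝ) ^ ν ≤ (p : ℝ)) = d.primeFactors := by
    apply Finset.filter_true_of_mem
    intro p hp
    exact (hr p (Nat.primeFactors_mono hdvd hn hp)).le
  rw [hfilter]
  have h := Nat.prod_factorization_pow_eq_self hd
  rwa [Finsupp.prod, Nat.support_factorization] at h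

/-- `smoothPart_eq_one_of_rough` — lemma of the line skeleton `sieve_decomposition` (v21, seat `linewriter-parity-smallroutes-1`), re-homed verbatim. [folklore] -/
theorem smoothPart_eq_one_of_rough {ν : ℝ} {n d : ℕ} (hn : n ≠ 0) (hr : IsRough ν n) (hdvd : d ∣ n)
    (hd : d ≠ 0) : smoothPart ((n : ℝ) ^ ν) d = 1 := by
  rw [smoothPart, roughPart_eq_self_of_rough hn hr hdvd hd, Nat.div_self (Nat.pos_of_ne_zero hd)]

/-- `apply_pvec_eq_zero_of_sqrt_lt` — lemma of the line skeleton `sieve_decomposition` (v21, seat `linewriter-parity-smallroutes-1`), re-homed verbatim. [folklore] -/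
theorem apply_pvec_eq_zero_of_sqrt_lt {ν : ℝ} {g : VecFn} (hadm : Admissible ν g) {n d : ℕ} (hn : 2 ≤ n)
    (hd0 : d ≠ 0) (hlt : (n : ℝ) ^ (1 / 2 : ℝ) < d) : g d.primeFactorsList.length (pvec n d) = 0 := by
  obtain ⟨-, -, -, hsupp, -⟩ := hadm
  by_contra hne
  rcases hsupp _ _ hne with h0 | ⟨-, hsum⟩
  · have hnil : d.primeFactorsList = [] := List.eq_nil_of_length_eq_zero h0
    rcases (Nat.primeFactorsList_eq_nil d).1 hnil with h | h
    · exact hd0 h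
    · subst h
      simp only [Nat.cast_one] at hlt
      have h1n : (1 : ℝ) ≤ (n : ℝ) ^ (1 / 2 : ℝ) :=
        Real.one_le_rpow (by exact_mod_cast (by omega : 1 ≤ n)) (by norm_num)
      linarith
  · rw [_root_.Summit.Parity.GeneralizedHardyLittlewood.FordMaynardSieveConst01651SieveConst01651.sum_pvec' hd0] at hsum
    have hlogn : 0 < Real.log n := Real.log_pos (by exact_mod_cast (by omega : 1 < n))
    have h1 : Real.log d ≤ (1 / 2 : ℝ) * Real.log n := by rwa [div_le_iff₀ hlogn] at hsum
    have hnpos : (0 : ℝ) < n := by exact_mod_cast (by omega : 0 < n)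
    have h2 := Real.log_lt_log (Real.rpow_pos_of_pos hnpos _) hlt
    rw [Real.log_rpow hnpos] at h2
    linarith

/-- `Gwt_eq_of_rough` — lemma of the line skeleton `sieve_decomposition` (v21, seat `linewriter-parity-smallroutes-1`), re-homed verbatim. [folklore] -/
theorem Gwt_eq_of_rough {ν : ℝ} {g : VecFn} (hadm : Admissible ν g) {n d : ℕ} (hn : 2 ≤ n) (hr : IsRough ν n)
    (hdvd : d ∣ n) : Gwt g ν n d = g d.primeFactorsList.length (pvec n d) := by
  have hn0 : n ≠ 0 := by omega
  have hd0 : d ≠ 0 := ne_zero_of_dvd_ne_zero hn0 hdvd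
  have key : ∀ d' : ℕ, d' = d →
      g d'.primeFactorsList.length (pvec n d') = g d.primeFactorsList.length (pvec n d) := by
    intro d' h; subst h; rfl
  unfold Gwt
  split_ifs with hle
  · rw [smoothPart_eq_one_of_rough hn0 hr hdvd hd0, ArithmeticFunction.moebius_apply_one,
      key _ (roughPart_eq_self_of_rough hn0 hr hdvd hd0)]
    push_cast
    ring
  · exact (apply_pvec_eq_zero_of_sqrt_lt hadm hn hd0 (not_le.1 hle)).symm

/-- `Hwt_eq_sum_of_rough` — lemma of the line skeleton `sieve_decomposition` (v21, seat `linewriter-parity-smallroutes-1`), re-homed verbatim. [folklore] -/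
theorem Hwt_eq_sum_of_rough {ν : ℝ} {g : VecFn} (hadm : Admissible ν g) {n : ℕ} (hn : 2 ≤ n) (hr : IsRough ν n) :
    Hwt g ν n = ∑ d ∈ n.divisors, g d.primeFactorsList.length (pvec n d) :=
  Finset.sum_congr rfl fun _ hd => Gwt_eq_of_rough hadm hn hr (Nat.dvd_of_mem_divisors hd)

/-- `apply_congr_ofFn` — lemma of the line skeleton `sieve_decomposition` (v21, seat `linewriter-parity-smallroutes-1`), re-homed verbatim. [folklore] -/
theorem apply_congr_ofFn (g : VecFn) {m m' : ℕ} {f : Fin m → ℝ} {f' : Fin m' → ℝ}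
    (h : List.ofFn f = List.ofFn f') : g m f = g m' f' := by
  rw [List.ofFn_inj'] at h
  cases h
  rfl

/-- `ofFn_pvec` — lemma of the line skeleton `sieve_decomposition` (v21, seat `linewriter-parity-smallroutes-1`), re-homed verbatim. [folklore] -/
theorem ofFn_pvec (n d : ℕ) :
    List.ofFn (pvec n d) = d.primeFactorsList.map (fun q : ℕ => Real.log q / Real.log n) := by
  unfold pvec
  simp only [List.get_eq_getElem]
  exact List.ofFn_getElem_eq_map d.primeFactorsList (fun q : ℕ => Real.log q / Real.log n)

/-- `idxProd_dvd` — lemma of the line skeleton `sieve_decomposition` (v21, seat `linewriter-parity-smallroutes-1`), re-homed verbatim. [folklore] -/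
theorem idxProd_dvd {n : ℕ} (hn : n ≠ 0) (A : Finset (Fin n.primeFactorsList.length)) : idxProd n A ∣ n := by
  have h : ∏ i, n.primeFactorsList.get i = n := by
    simp only [List.get_eq_getElem, Fin.prod_univ_getElem, Nat.prod_primeFactorsList hn]
  unfold idxProd
  conv_rhs => rw [← h]
  exact Finset.prod_dvd_prod_of_subset _ _ _ (Finset.subset_univ A)

/-- `primeFactorsList_idxProd` — lemma of the line skeleton `sieve_decomposition` (v21, seat `linewriter-parity-smallroutes-1`), re-homed verbatim. [folklore] -/
theorem primeFactorsList_idxProd (n : ℕ) (A : Finset (Fin n.primeFactorsList.length)) :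
    (idxProd n A).primeFactorsList = List.ofFn (fun i => n.primeFactorsList.get (A.orderEmbOfFin rfl i)) := by
  symm
  apply List.Perm.eq_of_sortedLE
  · apply Monotone.sortedLE_ofFn
    exact (List.sortedLE_iff_monotone_get.1 (Nat.primeFactorsList_sorted n)).comp (A.orderEmbOfFin rfl).monotone
  · exact Nat.primeFactorsList_sorted _
  · apply Nat.primeFactorsList_unique
    · calc (List.ofFn fun i => n.primeFactorsList.get (A.orderEmbOfFin rfl i)).prod
          = ∏ i, n.primeFactorsList.get (A.orderEmbOfFin rfl i) := List.prod_ofFn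
        _ = ∏ x ∈ Finset.univ.image (A.orderEmbOfFin rfl), n.primeFactorsList.get x :=
            (Finset.prod_image fun i _ j _ h => (A.orderEmbOfFin rfl).injective h).symm
        _ = idxProd n A := by rw [Finset.image_orderEmbOfFin_univ]; rfl
    · intro p hp
      rw [List.mem_ofFn'] at hp
      obtain ⟨i, rfl⟩ := hp
      exact Nat.prime_of_mem_primeFactorsList (List.get_mem _ _)

/-- `apply_idxProd_eq` — lemma of the line skeleton `sieve_decomposition` (v21, seat `linewriter-parity-smallroutes-1`), re-homed verbatim. [folklore] -/
theorem apply_idxProd_eq (N n : ℕ) (g : VecFn) (A : Finset (Fin n.primeFactorsList.length)) :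
    g (idxProd n A).primeFactorsList.length (pvec N (idxProd n A))
      = g A.card (fun i => pvec N n (A.orderEmbOfFin rfl i)) := by
  apply apply_congr_ofFn
  rw [ofFn_pvec, primeFactorsList_idxProd n A, List.map_ofFn]
  rfl

/-- `idxProd_injective` — lemma of the line skeleton `sieve_decomposition` (v21, seat `linewriter-parity-smallroutes-1`), re-homed verbatim. [folklore] -/
theorem idxProd_injective {n : ℕ} (hn : n ≠ 0) (hsq : Squarefree n) : Function.Injective (idxProd n) := by
  intro A B hAB
  have hnd : n.primeFactorsList.Nodup := (Nat.squarefree_iff_nodup_primeFactorsList hn).1 hsq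
  have hinj : Function.Injective n.primeFactorsList.get := List.nodup_iff_injective_get.1 hnd
  have key : ∀ C : Finset (Fin n.primeFactorsList.length),
      (idxProd n C).primeFactors = C.image n.primeFactorsList.get := by
    intro C
    have hC : idxProd n C = ∏ p ∈ C.image n.primeFactorsList.get, p := by
      unfold idxProd
      exact (Finset.prod_image (f := fun p : ℕ => p) fun i _ j _ h => hinj h).symm
    rw [hC]
    apply Nat.primeFactors_prod
    intro p hp
    obtain ⟨i, -, rfl⟩ := Finset.mem_image.1 hp
    exact Nat.prime_of_mem_primeFactorsList (List.get_mem _ _)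
  have h := key A
  rw [hAB, key B] at h
  exact Finset.image_injective hinj h.symm

/-- `card_divisors_of_squarefree` — lemma of the line skeleton `sieve_decomposition` (v21, seat `linewriter-parity-smallroutes-1`), re-homed verbatim. [folklore] -/
theorem card_divisors_of_squarefree {n : ℕ} (hn : n ≠ 0) (hsq : Squarefree n) :
    n.divisors.card = 2 ^ n.primeFactorsList.length := by
  have hnd : n.primeFactorsList.Nodup := (Nat.squarefree_iff_nodup_primeFactorsList hn).1 hsq
  have h1 := Nat.sum_divisors_filter_squarefree hn (f := fun _ : ℕ => (1 : ℕ))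
  rw [Nat.divisors_filter_squarefree_of_squarefree hsq] at h1
  simp only [Finset.sum_const, smul_eq_mul, mul_one, Finset.card_powerset] at h1
  rw [h1, Nat.factors_eq, ← List.toFinset_card_of_nodup hnd]
  rfl

/-- `sum_divisors_eq_starSum` — lemma of the line skeleton `sieve_decomposition` (v21, seat `linewriter-parity-smallroutes-1`), re-homed verbatim. [folklore] -/
theorem sum_divisors_eq_starSum (N : ℕ) {n : ℕ} (hn : n ≠ 0) (hsq : Squarefree n) (g : VecFn) :
    ∑ d ∈ n.divisors, g d.primeFactorsList.length (pvec N d)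
      = starSum g n.primeFactorsList.length (pvec N n) := by
  classical
  have hinj := idxProd_injective hn hsq
  have himg : (Finset.univ : Finset (Finset (Fin n.primeFactorsList.length))).image (idxProd n)
      = n.divisors := by
    apply Finset.eq_of_subset_of_card_le
    · intro d hd
      obtain ⟨A, -, rfl⟩ := Finset.mem_image.1 hd
      exact Nat.mem_divisors.2 ⟨idxProd_dvd hn A, hn⟩
    · rw [Finset.card_image_of_injective _ hinj, Finset.card_univ, Fintype.card_finset, Fintype.card_fin,
        card_divisors_of_squarefree hn hsq]
  rw [← himg, Finset.sum_image fun A _ B _ h => hinj h]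
  unfold starSum
  exact Finset.sum_congr rfl fun A _ => apply_idxProd_eq N n g A

/-- `two_le_length_of_not_prime` — lemma of the line skeleton `sieve_decomposition` (v21, seat `linewriter-parity-smallroutes-1`), re-homed verbatim. [folklore] -/
theorem two_le_length_of_not_prime {n : ℕ} (hn : 2 ≤ n) (hp : ¬ n.Prime) : 2 ≤ n.primeFactorsList.length := by
  have hn0 : n ≠ 0 := by omega
  have hprod := Nat.prod_primeFactorsList hn0
  have hmem : ∀ p ∈ n.primeFactorsList, p.Prime := fun p hp => Nat.prime_of_mem_primeFactorsList hp
  rcases hL : n.primeFactorsList with _ | ⟨p, _ | ⟨q, t⟩⟩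
  · rw [hL] at hprod
    simp at hprod
    omega
  · rw [hL] at hprod hmem
    simp at hprod
    exact absurd (hprod ▸ hmem p (by simp)) hp
  · simp

/-- `nu_lt_pvec` — lemma of the line skeleton `sieve_decomposition` (v21, seat `linewriter-parity-smallroutes-1`), re-homed verbatim. [folklore] -/
theorem nu_lt_pvec {ν : ℝ} {n : ℕ} (hn : 2 ≤ n) (hr : IsRough ν n) {d : ℕ} (hd : d ∣ n)
    (i : Fin d.primeFactorsList.length) : ν < pvec n d i := by
  have hn0 : n ≠ 0 := by omega
  have hnpos : (0 : ℝ) < n := by exact_mod_cast (by omega : 0 < n)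
  have hlogn : 0 < Real.log n := Real.log_pos (by exact_mod_cast (by omega : 1 < n))
  unfold pvec
  rw [lt_div_iff₀ hlogn]
  have hq : d.primeFactorsList.get i ∈ n.primeFactors := by
    have hqd : d.primeFactorsList.get i ∈ d.primeFactorsList := List.get_mem _ _
    rw [Nat.mem_primeFactors]
    exact ⟨Nat.prime_of_mem_primeFactorsList hqd, (Nat.dvd_of_mem_primeFactorsList hqd).trans hd, hn0⟩
  calc ν * Real.log n = Real.log ((n : ℝ) ^ ν) := (Real.log_rpow hnpos ν).symm
    _ < Real.log (d.primeFactorsList.get i : ℝ) := Real.log_lt_log (Real.rpow_pos_of_pos hnpos ν) (hr _ hq)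

/-- `pvec_nonneg` — lemma of the line skeleton `sieve_decomposition` (v21, seat `linewriter-parity-smallroutes-1`), re-homed verbatim. [folklore] -/
theorem pvec_nonneg {n : ℕ} (hn : 2 ≤ n) (d : ℕ) (i : Fin d.primeFactorsList.length) : 0 ≤ pvec n d i := by
  have hlogn : 0 < Real.log n := Real.log_pos (by exact_mod_cast (by omega : 1 < n))
  unfold pvec
  apply div_nonneg _ hlogn.le
  apply Real.log_nonneg
  exact_mod_cast Nat.pos_of_mem_primeFactorsList (List.get_mem _ i)

/-- `entries_of_sum_eq_one` — lemma of the line skeleton `sieve_decomposition` (v21, seat `linewriter-parity-smallroutes-1`), re-homed verbatim. [folklore] -/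
theorem entries_of_sum_eq_one {ν : ℝ} {K : ℕ} (hK : 2 ≤ K) {z : Fin K → ℝ} (hpos : ∀ l, 0 ≤ z l)
    (hlow : ∀ i, ν < z i) (hsum : ∑ i, z i = 1) : ∀ i, ν < z i ∧ z i < 1 - ν := by
  intro i
  refine ⟨hlow i, ?_⟩
  obtain ⟨j, hj⟩ : ∃ j : Fin K, j ≠ i := by
    by_cases hi : (i : ℕ) = 0
    · exact ⟨⟨1, by omega⟩, fun h => by rw [Fin.ext_iff] at h; simp at h; omega⟩
    · exact ⟨⟨0, by omega⟩, fun h => by rw [Fin.ext_iff] at h; simp at h; omega⟩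
  have h1 : z i + z j ≤ ∑ l, z l := by
    rw [← Finset.add_sum_erase _ _ (Finset.mem_univ i)]
    have : z j ≤ ∑ l ∈ Finset.univ.erase i, z l :=
      Finset.single_le_sum (f := fun l => z l) (fun l _ => hpos l) (Finset.mem_erase.2 ⟨hj, Finset.mem_univ j⟩)
    linarith
  linarith [hlow j]

/-- `sign_of_squarefree` — lemma of the line skeleton `sieve_decomposition` (v21, seat `linewriter-parity-smallroutes-1`), re-homed verbatim. [folklore] -/
theorem sign_of_squarefree {ν : ℝ} {g : VecFn} (hadm : Admissible ν g) {n : ℕ} (hn : 2 ≤ n) (hp : ¬ n.Prime)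
    (hr : IsRough ν n) (hsq : Squarefree n) :
    ∑ d ∈ n.divisors, g d.primeFactorsList.length (pvec n d) ≤ 0 := by
  have hn0 : n ≠ 0 := by omega
  rw [sum_divisors_eq_starSum n hn0 hsq]
  have hlogn : 0 < Real.log n := Real.log_pos (by exact_mod_cast (by omega : 1 < n))
  have hsum : ∑ i, pvec n n i = 1 := by rw [_root_.Summit.Parity.GeneralizedHardyLittlewood.FordMaynardSieveConst01651SieveConst01651.sum_pvec' hn0, div_self hlogn.ne']
  have hk2 := two_le_length_of_not_prime hn hp
  exact hadm.2.2.2.2 _ hk2 _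
    (entries_of_sum_eq_one hk2 (fun l => pvec_nonneg hn n l) (fun i => nu_lt_pvec hn hr dvd_rfl i) hsum) hsum

/-- `apply_eq_of_perm_ofFn` — lemma of the line skeleton `sieve_decomposition` (v21, seat `linewriter-parity-smallroutes-1`), re-homed verbatim. [folklore] -/
theorem apply_eq_of_perm_ofFn {g : VecFn} (hs : g.IsSymmetric) {m m' : ℕ} {f : Fin m → ℝ} {f' : Fin m' → ℝ}
    (h : (List.ofFn f).Perm (List.ofFn f')) : g m f = g m' f' := by
  rw [← hs m (Tuple.sort f) f, ← hs m' (Tuple.sort f') f']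
  apply apply_congr_ofFn
  apply List.Perm.eq_of_sortedLE (Tuple.monotone_sort f).sortedLE_ofFn (Tuple.monotone_sort f').sortedLE_ofFn
  exact ((Equiv.Perm.ofFn_comp_perm _ _).trans h).trans (Equiv.Perm.ofFn_comp_perm _ _).symm

/-- `gam_coe_ofFn` — lemma of the line skeleton `sieve_decomposition` (v21, seat `linewriter-parity-smallroutes-1`), re-homed verbatim. [folklore] -/
theorem gam_coe_ofFn {g : VecFn} (hs : g.IsSymmetric) {m : ℕ} (f : Fin m → ℝ) :
    gam g (↑(List.ofFn f) : Multiset ℝ) = g m f := by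
  unfold gam
  apply apply_eq_of_perm_ofFn hs
  rw [List.ofFn_get]
  exact Multiset.coe_eq_coe.1 (Multiset.coe_toList _)

end Summit.Parity.GeneralizedHardyLittlewood.FordMaynardSieveConst01651SieveDecomposition

end
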